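import Literature.NumberTheory.Automorphic.KisinTaylorWilesHypothesisFive
import Literature.NumberTheory.Automorphic.TotallyRealNonModularImages
import Literature.NumberTheory.GaloisRepresentations.OddSubgroupCartanNormalizerGL2Fp
import HarnessLib

/-!
# Freitas–Le Hung–Siksek 2015, Remark (iii) after Cor. 2.1: the mod-`5` image of a non-modular
# elliptic curve over a totally real field CONTAINING `√5` (theorems only)

Topic `Literature/NumberTheory/Automorphic`; companion of `FLSResidualImageCriteria.lean`
(`FLS2015_theorem3`; Prop. 9.1 and the dictionary (i)–(iii) of its proof),
`KisinTaylorWilesHypothesisFive.lean` (`det ρ̄_{E,5} = ±1` over `K ∋ √5`: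
`det_eq_one_or_eq_neg_one_of_isTorsionGaloisRep_of_isSquare_five`) and
`TotallyRealModularityQuarticSixteenCurves.lean` (`Box2022.clause_five`: the coarse trichotomy
`{b5, s5, ns5}`).  Typed for the cell `pub/lg-quartmod` (F-L1) and its route
`Langlands/SqrtFiveQuarticCovers`, whose support item `GroupCensusFive` (a finite census of
subgroups of `GL₂(𝔽₅)`, Summits-side) takes as INPUT exactly the four properties of the image
delivered here; the census itself ("three subgroups of orders `6`, `8` and `12`") is NOT restated
or proved in this file.  Nothing here proves modularity of anything.

## What the source prints (held text `paper:arxiv-1310.7088`, pp. 19–20; published §§9–10)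

N. Freitas, B. V. Le Hung, S. Siksek, Invent. Math. 201 (2015) 159–206 [FreitasLeHungSiksek2015].
Proof of Prop. 9.1 (held text "Prop. 1.1", p. 19): "Write `G = ρ̄(G_K)`. We observe that `G`
satisfies the following: (i) `G` is irreducible, and `G ∩ SL₂(𝔽_p)` is absolutely reducible;
(ii) `G` odd (in other words, there is some element `c ∈ G` with eigenvalues `1` and `-1`);
(iii) `det(G) = 𝔽_p^*`. Indeed, (i) follows by assumption and Proposition 4.1, (ii) is a
consequence of `K` having a real embedding, and (iii) follows from `K ∩ ℚ(ζ_p) = ℚ`. One proof of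
the proposition is to enumerate all subgroups `G` of `GL₂(𝔽_p)` […]".  **Remark (iii)** after
Cor. 2.1 (held text p. 20; published Cor. 10.1): "In (b) we really need the condition
`K ≠ ℚ(√5)`. To see this let `K = ℚ(√5)`. Let `G = ρ̄(G_K)` where `ρ̄ = ρ̄_{E,5}` and `E/K` is an
elliptic curve. Then `det(G) = χ₅(Gal(ℚ(ζ₅)/ℚ(√5))) = {1̄, 4̄} ⊂ 𝔽₅^*`. Now, in the proof of
Proposition 9.1, if we replace the condition `det(G) = 𝔽₅^*` with `det(G) = {1̄, 4̄}` we obtain three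
subgroups of `GL₂(𝔽₅)` of orders `6`, `8` and `12`. The subgroup of order `8` is contained in the
normalizer of a split Cartan subgroup, but not in the normalizer of any non-split Cartan subgroup.
The subgroups of orders `6` and `12` are contained in the normalizer of a non-split Cartan subgroup
but not in the normalizer of any split Cartan subgroup."

## What this file proves

The SETTING of Remark (iii) for every field `K ∋ √5` with a real place, i.e. the hypotheses
(i), (ii) and (iii′) `det(G) ⊆ {±1}` that the remark feeds into the enumeration, for the image
`G = ρ̄(Γ_K)` of an IRREDUCIBLE framing `ρ̄` of `E[5]` whose restriction to `Γ_{K(ζ₅)}` is not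
absolutely irreducible — rendered token-compatibly with the hypotheses of the route item
`Summit.Langlands.Langlands.Theses.SqrtFiveQuarticCovers.GroupCensusFive`:
(a) `det g = 1 ∨ det g = -1` for `g ∈ G`; (b) some `c ∈ G` has `tr c = 0` and `det c = -1` (a
complex conjugation: `c² = 1`, `det c = χ̄₅(c) = -1`, hence `tr c = 0` by Cayley–Hamilton,
`FLS2015.trace_eq_zero_of_mul_self_eq_one`); (c) `G` has no common eigenline in `𝔽₅²`
(irreducibility); (d) the determinant-one elements of `G` do not span `M₂(𝔽₅)` — the route's
Burnside rendering of "`G ∩ SL₂(𝔽₅)` absolutely reducible", derived here from the common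
eigenvector over an extension of `𝔽₅` (`span_ne_top_of_common_eigenvector`).  Combined with FLS
Thm. 3 (`FLS2015_theorem3`, as a hypothesis): **a non-modular `E` over a totally real `K ∋ √5`
has a framing of `E[5]` which is Borel, or whose image satisfies (a)–(d)**
(`modFive_image_of_not_isAutomorphicOfWeightZero`, and the weak-rendering form
`modFive_image_of_not_isModularEllipticCurve` with `IsTotallyReal K` explicit, as in the route).

## References

* [FreitasLeHungSiksek2015] Invent. Math. 201 (2015) 159–206 = arXiv:1310.7088: proof of Prop. 9.1
  (held text p. 19), Remark (iii) after Cor. 10.1 (held text p. 20), Thm. 3 (p. 4), Prop. 4.1 (p. 10).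
* Route file `Summits/Langlands/Langlands/Theses/SqrtFiveQuarticCovers.lean` (items
  `ReductionToRefinedLocus`, `GroupCensusFive`) — for the token shapes only; nothing is imported
  from `Summits/`.
-/

open scoped NumberField MatrixGroups
open NumberField Field Matrix Literature.NumberTheory.GaloisRepresentations

noncomputable section

namespace Literature.NumberTheory.Automorphic

namespace FLS2015

universe u v

/-! ### Burnside rendering: a common eigenvector over an extension keeps the span proper -/

/-- **If a set of `2 × 2` matrices over `𝔽_p` has a common eigenvector after some base change,
its `𝔽_p`-span is not all of `M₂(𝔽_p)`.**  For `f : 𝔽_p → B` a field extension and `0 ≠ v ∈ B²`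
an eigenvector of `f(M)` for every `M ∈ S`, the matrices with `v` as eigenvector (after `f`) form
an `𝔽_p`-submodule containing `S`, hence its span; but the elementary matrix `E₂₁` (if `v₀ ≠ 0`) or
`E₁₂` (if `v₀ = 0 ≠ v₁`) does not have `v` as an eigenvector.  This converts "`G ∩ SL₂(𝔽_p)` is
absolutely reducible" (a common eigenvector over `F̄_p`) into the spanning form used by the route
`Langlands/SqrtFiveQuarticCovers` ("determinant-`1` part not spanning `M₂(𝔽₅)` (= is absolutely
reducible, Burnside)"). [cite: FreitasLeHungSiksek2015, Prop. 9.1 (proof, (i)) and Prop. 4.1] -/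
theorem span_ne_top_of_common_eigenvector {p : ℕ} [Fact p.Prime] {B : Type v} [Field B]
    (f : ZMod p →+* B) {v : Fin 2 → B} (hv : v ≠ 0) (S : Set (Matrix (Fin 2) (Fin 2) (ZMod p)))
    (hS : ∀ M ∈ S, ∃ a : B, (M.map f) *ᵥ v = a • v) :
    Submodule.span (ZMod p) S ≠ ⊤ := by
  -- the submodule of matrices having `v` as an eigenvector after `f`
  let W : Submodule (ZMod p) (Matrix (Fin 2) (Fin 2) (ZMod p)) :=
    { carrier := {M | ∃ a : B, (M.map f) *ᵥ v = a • v}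
      zero_mem' := ⟨0, by simp⟩
      add_mem' := by
        rintro M N ⟨a, ha⟩ ⟨b, hb⟩
        exact ⟨a + b, by rw [Matrix.map_add f (map_add f), Matrix.add_mulVec, ha, hb, add_smul]⟩
      smul_mem' := by
        rintro c M ⟨a, ha⟩
        refine ⟨f c * a, ?_⟩
        have : (c • M).map f = f c • M.map f := by
          ext i j
          simp [Matrix.map_apply, smul_eq_mul]
        rw [this, Matrix.smul_mulVec, ha, smul_smul] }
  have hle : Submodule.span (ZMod p) S ≤ W := Submodule.span_le.mpr fun M hM => hS M hM
  intro htop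
  rw [htop, top_le_iff] at hle
  -- the two elementary matrices `E₂₁`, `E₁₂` after `f`, and their action on `v`
  have hE21 : ((!![0, 0; 1, 0] : Matrix (Fin 2) (Fin 2) (ZMod p)).map f) *ᵥ v = ![0, v 0] := by
    have hm : (!![0, 0; 1, 0] : Matrix (Fin 2) (Fin 2) (ZMod p)).map f = !![0, 0; 1, 0] := by
      ext i j; fin_cases i <;> fin_cases j <;> simp
    rw [hm]
    ext i; fin_cases i <;> simp [Matrix.mulVec, dotProduct, Fin.sum_univ_two]
  have hE12 : ((!![0, 1; 0, 0] : Matrix (Fin 2) (Fin 2) (ZMod p)).map f) *ᵥ v = ![v 1, 0] := by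
    have hm : (!![0, 1; 0, 0] : Matrix (Fin 2) (Fin 2) (ZMod p)).map f = !![0, 1; 0, 0] := by
      ext i j; fin_cases i <;> fin_cases j <;> simp
    rw [hm]
    ext i; fin_cases i <;> simp [Matrix.mulVec, dotProduct, Fin.sum_univ_two]
  by_cases h0 : v 0 = 0
  · -- `v₀ = 0 ≠ v₁`: use `E₁₂`, `E₁₂ v = (v₁, 0)` is not a multiple of `v = (0, v₁)`
    have h1 : v 1 ≠ 0 := by
      intro h1; apply hv; funext i; fin_cases i <;> assumption
    obtain ⟨a, ha⟩ : (!![0, 1; 0, 0] : Matrix (Fin 2) (Fin 2) (ZMod p)) ∈ W :=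
      hle ▸ Submodule.mem_top
    rw [hE12] at ha
    have e0 : v 1 = a * v 0 := by
      have := congr_fun ha 0
      simpa only [Matrix.cons_val_zero, Pi.smul_apply, smul_eq_mul] using this
    rw [h0, mul_zero] at e0
    exact h1 e0
  · -- `v₀ ≠ 0`: use `E₂₁`, `E₂₁ v = (0, v₀)` is not a multiple of `v`
    obtain ⟨a, ha⟩ : (!![0, 0; 1, 0] : Matrix (Fin 2) (Fin 2) (ZMod p)) ∈ W :=
      hle ▸ Submodule.mem_top
    rw [hE21] at ha
    have e0 : (0 : B) = a * v 0 := by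
      have := congr_fun ha 0
      simpa only [Matrix.cons_val_zero, Pi.smul_apply, smul_eq_mul] using this
    have e1 : v 0 = a * v 1 := by
      have := congr_fun ha 1
      simpa only [Matrix.cons_val_one, Matrix.cons_val_zero, Matrix.head_cons, Pi.smul_apply,
        smul_eq_mul] using this
    rcases mul_eq_zero.mp e0.symm with ha0 | hv0
    · rw [ha0, zero_mul] at e1
      exact h0 e1
    · exact h0 hv0

/-! ### The setting of Remark (iii): the image of an irreducible framing over `K ∋ √5` -/

/-- **Freitas–Le Hung–Siksek 2015, Remark (iii) after Cor. 2.1 — the hypotheses (i), (ii), (iii′)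
of the enumeration, for ANY `K ∋ √5` with a real place.**  Let `K` be a number field with a real
embedding and `√5 ∈ K` (`IsSquare (5 : K)`), `E / K` an elliptic curve, `ρ̄` an IRREDUCIBLE
framing of the Galois action on `E[5]`, and `L` a model of `K(ζ₅)` with `ρ̄|_{Γ_L}` not absolutely
irreducible.  Then the image `G = ρ̄(Γ_K) ≤ GL₂(𝔽₅)` satisfies: (a) `det g ∈ {1, -1}` for all
`g ∈ G` ("`det(G) = χ₅(Gal(ℚ(ζ₅)/ℚ(√5))) = {1̄, 4̄}`":
`det_eq_one_or_eq_neg_one_of_isTorsionGaloisRep_of_isSquare_five`); (b) some `c ∈ G` has trace `0`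
and determinant `-1` ((ii) "`G` odd": the image of a complex conjugation,
`exists_mul_self_eq_one_and_det_eq_neg_one_of_det_eq`, trace by
`FLS2015.trace_eq_zero_of_mul_self_eq_one`); (c) `G` fixes no line of `𝔽₅²` ((i), first half:
`FLS2015.range_irreducible`); (d) the determinant-one elements of `G` do not span `M₂(𝔽₅)` ((i),
second half, "`G ∩ SL₂(𝔽₅)` absolutely reducible", through Prop. 4.1 (i)
`exists_eigenvector_of_det_eq_one_of_not_isAbsolutelyIrreducible_restrictField` and
`span_ne_top_of_common_eigenvector`).  Shapes (a)–(d) are, token for token, the hypotheses of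
the route item `SqrtFiveQuarticCovers.GroupCensusFive`.
[cite: FreitasLeHungSiksek2015, Remark (iii) after Cor. 2.1 (p. 20 of arXiv:1310.7088) and Prop. 9.1 (proof, (i)–(iii))] -/
theorem remark_iii_image {K : Type u} [Field K] [NumberField K] [Fact (Nat.Prime 5)]
    (φ : K →+* ℝ) (h5 : IsSquare (5 : K)) (E : WeierstrassCurve K) [E.IsElliptic]
    {ρ : ModPGaloisRep K (ZMod 5) 2} (hρ : E.IsTorsionGaloisRep 5 ρ)
    (hirr : FramedRep.IsIrreducible ρ) (L : Type v) [Field L] [Algebra K L]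
    [IsCyclotomicExtension {5} K L]
    (hred : ¬ FramedRep.IsAbsolutelyIrreducible (FramedGaloisRep.restrictField L ρ)) :
    (∀ g ∈ ρ.toMonoidHom.range,
        Matrix.det ((g : GL (Fin 2) (ZMod 5)) : Matrix (Fin 2) (Fin 2) (ZMod 5)) = 1 ∨
          Matrix.det ((g : GL (Fin 2) (ZMod 5)) : Matrix (Fin 2) (Fin 2) (ZMod 5)) = -1) ∧
      (∃ c ∈ ρ.toMonoidHom.range,
        Matrix.trace ((c : GL (Fin 2) (ZMod 5)) : Matrix (Fin 2) (Fin 2) (ZMod 5)) = 0 ∧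
          Matrix.det ((c : GL (Fin 2) (ZMod 5)) : Matrix (Fin 2) (Fin 2) (ZMod 5)) = -1) ∧
      (¬ ∃ v : Fin 2 → ZMod 5, v ≠ 0 ∧ ∀ g ∈ ρ.toMonoidHom.range, ∃ a : ZMod 5,
          ((g : GL (Fin 2) (ZMod 5)) : Matrix (Fin 2) (Fin 2) (ZMod 5)) *ᵥ v = a • v) ∧
      Submodule.span (ZMod 5) ((fun g : GL (Fin 2) (ZMod 5) =>
          ((g : GL (Fin 2) (ZMod 5)) : Matrix (Fin 2) (Fin 2) (ZMod 5))) ''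
            {g : GL (Fin 2) (ZMod 5) | g ∈ ρ.toMonoidHom.range ∧
              Matrix.det ((g : GL (Fin 2) (ZMod 5)) : Matrix (Fin 2) (Fin 2) (ZMod 5)) = 1}) ≠ ⊤ := by
  haveI : NeZero ((5 : ℕ) : K) := NeZero.charZero
  have hdet : ∀ σ, Matrix.GeneralLinearGroup.det (ρ σ) = modPCyclotomicCharacterZMod K 5 σ :=
    E.det_eq_modPCyclotomicCharacter_of_isTorsionGaloisRep_holds 5 ρ hρ
  refine ⟨?_, ?_, ?_, ?_⟩
  · -- (a) `det(G) ⊆ {±1}`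
    rintro _ ⟨σ, rfl⟩
    exact det_eq_one_or_eq_neg_one_of_isTorsionGaloisRep_of_isSquare_five h5 E hρ σ
  · -- (b) the image of a complex conjugation
    obtain ⟨c, hcc, hcdet⟩ := exists_mul_self_eq_one_and_det_eq_neg_one_of_det_eq ρ hdet φ
    exact ⟨ρ c, ⟨c, rfl⟩,
      Literature.NumberTheory.GaloisRepresentations.FLS2015.trace_eq_zero_of_mul_self_eq_one
        (p := 5) (by decide) hcc hcdet,
      Literature.NumberTheory.GaloisRepresentations.FLS2015.det_coe_eq_neg_one hcdet⟩
  · -- (c) irreducible: no common eigenline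
    rintro ⟨v, hv, hall⟩
    obtain ⟨g, hg, hne⟩ := range_irreducible ρ hirr v hv
    obtain ⟨a, ha⟩ := hall g hg
    exact hne a ha
  · -- (d) the determinant-one part has a common eigenvector over an extension
    obtain ⟨B, _, f, v, hv, hB⟩ :=
      exists_eigenvector_of_det_eq_one_of_not_isAbsolutelyIrreducible_restrictField ρ hdet L hred
    refine span_ne_top_of_common_eigenvector f hv _ ?_
    rintro _ ⟨g, ⟨⟨σ, rfl⟩, hg1⟩, rfl⟩
    refine hB σ (Units.ext ?_)
    rw [Matrix.GeneralLinearGroup.val_det_apply, Units.val_one]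
    exact hg1

/-! ### Non-modular curves over totally real `K ∋ √5` (with FLS Thm. 3) -/

/-- **The mod-`5` image of a NON-MODULAR elliptic curve over a totally real field containing `√5`**
(FLS Thm. 3 at `p = 5` + Remark (iii) after Cor. 2.1): assuming `FLS2015_theorem3`, for `K`
totally real with `√5 ∈ K` and `E / 𝓞 K` (`Δ ≠ 0`) not automorphic of weight zero, SOME framing
`ρ̄` of `(E ⊗ K)[5]` is upper triangular (Borel — the curve `X(b5)`), or its image `G = ρ̄(Γ_K)`
satisfies (a) `det(G) ⊆ {±1}`, (b) `G ∋ c` with `tr c = 0`, `det c = -1`, (c) `G` irreducible,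
(d) the determinant-one part of `G` does not span `M₂(𝔽₅)` — the input of the route's subgroup
census (`GroupCensusFive` ⇒ `G` conjugate into `H8` or `H12`; FLS: "three subgroups of orders `6`,
`8` and `12`").  Thm. 3 gives a framing with `ρ̄|_{Γ_{K(ζ₅)}}` not absolutely irreducible
(`FLS2015.exists_not_isAbsolutelyIrreducible…`-style contrapositive); a reducible one is
conjugated into the Borel (`exists_isTorsionGaloisRep_borel_of_not_isIrreducible`), an irreducible
one is handled by `remark_iii_image`. [cite: FreitasLeHungSiksek2015, Thm. 3 and Remark (iii) after Cor. 2.1] -/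
theorem modFive_image_of_not_isAutomorphicOfWeightZero (h3 : FLS2015_theorem3) (K : Type)
    [Field K] [NumberField K] [IsTotallyReal K] (h5 : IsSquare (5 : K))
    (E : WeierstrassCurve (𝓞 K)) (hΔ : E.Δ ≠ 0) (hne : ¬ IsAutomorphicOfWeightZero E) :
    ∃ ρ : FramedGaloisRep K (ZMod 5) 2, (E.baseChange K).IsTorsionGaloisRep 5 ρ ∧
      ((∀ σ : absoluteGaloisGroup K,
          ((ρ σ : GL (Fin 2) (ZMod 5)) : Matrix (Fin 2) (Fin 2) (ZMod 5)) 1 0 = 0) ∨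
        ((∀ g ∈ ρ.toMonoidHom.range,
            Matrix.det ((g : GL (Fin 2) (ZMod 5)) : Matrix (Fin 2) (Fin 2) (ZMod 5)) = 1 ∨
              Matrix.det ((g : GL (Fin 2) (ZMod 5)) : Matrix (Fin 2) (Fin 2) (ZMod 5)) = -1) ∧
          (∃ c ∈ ρ.toMonoidHom.range,
            Matrix.trace ((c : GL (Fin 2) (ZMod 5)) : Matrix (Fin 2) (Fin 2) (ZMod 5)) = 0 ∧
              Matrix.det ((c : GL (Fin 2) (ZMod 5)) : Matrix (Fin 2) (Fin 2) (ZMod 5)) = -1) ∧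
          (¬ ∃ v : Fin 2 → ZMod 5, v ≠ 0 ∧ ∀ g ∈ ρ.toMonoidHom.range, ∃ a : ZMod 5,
              ((g : GL (Fin 2) (ZMod 5)) : Matrix (Fin 2) (Fin 2) (ZMod 5)) *ᵥ v = a • v) ∧
          Submodule.span (ZMod 5) ((fun g : GL (Fin 2) (ZMod 5) =>
              ((g : GL (Fin 2) (ZMod 5)) : Matrix (Fin 2) (Fin 2) (ZMod 5))) ''
                {g : GL (Fin 2) (ZMod 5) | g ∈ ρ.toMonoidHom.range ∧
                  Matrix.det ((g : GL (Fin 2) (ZMod 5)) : Matrix (Fin 2) (Fin 2) (ZMod 5)) = 1}) ≠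
            ⊤)) := by
  haveI : Fact (Nat.Prime 5) := ⟨by norm_num⟩
  haveI := isElliptic_baseChange hΔ
  obtain ⟨φ⟩ := exists_realEmbedding K
  -- FLS Thm. 3 at `p = 5`, contrapositive
  obtain ⟨ρ, hρ, L, _, _, _, hred⟩ :
      ∃ ρ : ModPGaloisRep K (ZMod 5) 2, (E.baseChange K).IsTorsionGaloisRep 5 ρ ∧
        ∃ (L : Type) (_ : Field L) (_ : Algebra K L) (_ : IsCyclotomicExtension {5} K L),
          ¬ FramedRep.IsAbsolutelyIrreducible (FramedGaloisRep.restrictField L ρ) := by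
    by_contra hall
    push Not at hall
    refine hne (h3 K E hΔ 5 (Or.inr rfl) ?_)
    intro ρ hρ L _ _ _
    exact hall ρ hρ L inferInstance inferInstance inferInstance
  by_cases hirr : FramedRep.IsIrreducible ρ
  · exact ⟨ρ, hρ, Or.inr (remark_iii_image φ h5 (E.baseChange K) hρ hirr L hred)⟩
  · obtain ⟨ρ', hρ', hB⟩ := exists_isTorsionGaloisRep_borel_of_not_isIrreducible hρ hirr
    exact ⟨ρ', hρ', Or.inl hB⟩

/-- **Weak-rendering form, token-compatible with the route statements** (`IsTotallyReal K` as an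
explicit hypothesis; "`√5 ∈ K`" as `∃ r : K, r ^ 2 = 5`; non-modularity in the trace-only sense
`¬ IsModularEllipticCurve K E`): assuming `FLS2015_theorem3`, a non-modular `E / 𝓞 K` over a
totally real `K ∋ √5` has a framing of `E[5]` which is Borel or whose image satisfies (a)–(d).
[cite: FreitasLeHungSiksek2015, Thm. 3 and Remark (iii) after Cor. 2.1] -/
theorem modFive_image_of_not_isModularEllipticCurve (h3 : FLS2015_theorem3) (K : Type) [Field K]
    [NumberField K] (hK : IsTotallyReal K) (h5 : ∃ r : K, r ^ 2 = 5) (E : WeierstrassCurve (𝓞 K))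
    (hΔ : E.Δ ≠ 0) (hE : ¬ IsModularEllipticCurve K E) :
    ∃ ρ : FramedGaloisRep K (ZMod 5) 2, (E.baseChange K).IsTorsionGaloisRep 5 ρ ∧
      ((∀ σ : absoluteGaloisGroup K,
          ((ρ σ : GL (Fin 2) (ZMod 5)) : Matrix (Fin 2) (Fin 2) (ZMod 5)) 1 0 = 0) ∨
        ((∀ g ∈ ρ.toMonoidHom.range,
            Matrix.det ((g : GL (Fin 2) (ZMod 5)) : Matrix (Fin 2) (Fin 2) (ZMod 5)) = 1 ∨
              Matrix.det ((g : GL (Fin 2) (ZMod 5)) : Matrix (Fin 2) (Fin 2) (ZMod 5)) = -1) ∧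
          (∃ c ∈ ρ.toMonoidHom.range,
            Matrix.trace ((c : GL (Fin 2) (ZMod 5)) : Matrix (Fin 2) (Fin 2) (ZMod 5)) = 0 ∧
              Matrix.det ((c : GL (Fin 2) (ZMod 5)) : Matrix (Fin 2) (Fin 2) (ZMod 5)) = -1) ∧
          (¬ ∃ v : Fin 2 → ZMod 5, v ≠ 0 ∧ ∀ g ∈ ρ.toMonoidHom.range, ∃ a : ZMod 5,
              ((g : GL (Fin 2) (ZMod 5)) : Matrix (Fin 2) (Fin 2) (ZMod 5)) *ᵥ v = a • v) ∧
          Submodule.span (ZMod 5) ((fun g : GL (Fin 2) (ZMod 5) =>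
              ((g : GL (Fin 2) (ZMod 5)) : Matrix (Fin 2) (Fin 2) (ZMod 5))) ''
                {g : GL (Fin 2) (ZMod 5) | g ∈ ρ.toMonoidHom.range ∧
                  Matrix.det ((g : GL (Fin 2) (ZMod 5)) : Matrix (Fin 2) (Fin 2) (ZMod 5)) = 1}) ≠
            ⊤)) := by
  haveI := hK
  obtain ⟨r, hr⟩ := h5
  exact modFive_image_of_not_isAutomorphicOfWeightZero h3 K ⟨r, by rw [← sq, hr]⟩ E hΔ
    (not_isAutomorphicOfWeightZero_of_not_isModularEllipticCurve hΔ hE)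

end FLS2015

end Literature.NumberTheory.Automorphic

end
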